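import Literature.NumberTheory.Transcendental.KZCubePolynomialKernel
import Literature.NumberTheory.Transcendental.KZRulesAssociator
import Literature.NumberTheory.Transcendental.KZSemiCanonicalReductionProofs
import Literature.NumberTheory.Transcendental.KZMellinFibres
import Literature.NumberTheory.Transcendental.KZBallPeelingAux
import Summits.KontsevichZagierPeriods.KontsevichZagierPeriods.Theorems.HyperbolicBlochOffTetraSectorKernelStubAffineOrbit

/-!
# `VolumeFormOffPlane` (stmt-KontsevichZagierPeriods-14935) — line `Sketch`, skeleton v7:
stub `stub_polynomialBoxCell` (A RATIONAL POLYNOMIAL OVER A RATIONAL BOX IS A K-CELL)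

v7 of the line introduces K-CELLS: representations `ρ` carrying a certificate
`[ρ] − [pt, v] ∈ KZ.relations` with `v` real algebraic (`[pt, v] = KZ.IntegralRep.unit.constMul v hv`).
This file proves that a representation on an open rational box `{aᵢ < xᵢ < bᵢ}` (`a, b ∈ ℚᵈ`,
`a < b`) whose integrand is a polynomial `p` with rational coefficients is a K-cell (indeed with
`v = ∫ p ∈ ℚ`). Moves, all inside Kontsevich–Zagier's rules:

* `pbc_descent` — `[[0,1]^{M+1}, p] ≡ [[0,1]^M, g]` for a polynomial `g` in one variable less: one
  Stokes move along the last variable with a polynomial primitive `G` (`KZ.RFun.stokes`,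
  `KZ.exists_pderiv_eq`), the faces `G(·,1) − G(·,0)` being the polynomial `g`
  (adapted from the tree's `KZ.RFun.poly_rep_mem_relations_of_integral_eq_zero`,
  `Literature/NumberTheory/Transcendental/KZCubePolynomialKernel.lean`);
* `pbc_cube_toPoint` — iterating down to `M = 0`, where a polynomial in no variables is its
  constant coefficient `c ∈ ℚ` and `[[0,1]⁰, c] = [pt, c]` on the nose;
* `stub_polynomialBoxCell` — the rational box is ONE affine rule-(2) move (diagonal matrix
  `diag(b − a)`, shift `a`, Jacobian `∏ (bᵢ − aᵢ) ∈ ℚ`) away from the open unit cube with the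
  transported polynomial `q = (∏ (bᵢ − aᵢ)) · p(a + (b − a)y) ∈ ℚ[y]`, which differs from the tame
  closed-cube representation `[[0,1]ᵈ, q]` by the null boundary (rule (1)).

Sources: Kontsevich–Zagier 2001, §1.2 (rules (1)–(3)); folklore.
-/

noncomputable section

open MeasureTheory Set MvPolynomial
open Literature.NumberTheory.Transcendental
open Literature.ModelTheory.ExponentialFields (IsSemialgebraic)

namespace Summit.KontsevichZagierPeriods.SymplecticScissors.LogPolytope

/-- **Descent along the last variable**: for every rational polynomial `p` in `M + 1` variables
there is a rational polynomial `g` in `M` variables with `[[0,1]^{M+1}, p] − [[0,1]^M, g] ∈ relations`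
— one Stokes move with a polynomial primitive `G` of `p` along the last variable, `g = G(·,1) − G(·,0)`.
[Kontsevich–Zagier 2001, §1.2 rule (3)] [folklore] -/
theorem pbc_descent (M : ℕ) (p : MvPolynomial (Fin (M + 1)) ℚ) :
    ∃ g : MvPolynomial (Fin M) ℚ,
      KZ.of (KZ.RFun.poly p).rep - KZ.of (KZ.RFun.poly g).rep ∈ KZ.relations := by
  -- adapted from Literature/NumberTheory/Transcendental/KZCubePolynomialKernel.lean
  obtain ⟨G, hG⟩ := KZ.exists_pderiv_eq (Fin.last M) p
  set T : KZ.RFun (M + 1) := KZ.RFun.poly G with hT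
  have hdl : ∀ x ∈ KZ.cube (M + 1), T.dlast.fn x = aeval x p := fun x _ => by
    simp [hT, KZ.RFun.dlast, KZ.RFun.poly, KZ.RFun.fn, hG]
  have e1 : KZ.of (KZ.RFun.poly p).rep - KZ.of T.dlast.rep ∈ KZ.relations :=
    KZ.RFun.rel_of_eqOn fun x hx => by rw [KZ.RFun.fn_poly, hdl x hx]
  have hst := KZ.RFun.stokes T
  set F1 := T.face 1 ⟨zero_le_one, le_rfl⟩ with hF1
  set F0 := T.face 0 ⟨le_rfl, zero_le_one⟩ with hF0
  set g : MvPolynomial (Fin M) ℚ :=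
    bind₁ (KZ.RFun.faceSubst M 1) G - bind₁ (KZ.RFun.faceSubst M 0) G with hg
  have hgfn : ∀ x : Fin M → ℝ, (aeval x g : ℝ) = F1.fn x - F0.fn x := fun x => by
    rw [hg, map_sub, aeval_bind₁, aeval_bind₁, KZ.RFun.aeval_faceSubst, KZ.RFun.aeval_faceSubst,
      hF1, hF0, KZ.RFun.fn_face, KZ.RFun.fn_face, hT, KZ.RFun.fn_poly, KZ.RFun.fn_poly]
  have e2 : KZ.of F1.rep - KZ.of F0.rep - KZ.of (KZ.RFun.poly g).rep ∈ KZ.relations := by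
    have h := KZ.RFun.rel_sub F1 F0
    have h' : KZ.of (F1.sub F0).rep - KZ.of (KZ.RFun.poly g).rep ∈ KZ.relations :=
      KZ.RFun.rel_of_eqOn fun x hx => by rw [KZ.RFun.fn_sub hx, KZ.RFun.fn_poly, hgfn]
    have : KZ.of F1.rep - KZ.of F0.rep - KZ.of (KZ.RFun.poly g).rep =
        (KZ.of (F1.sub F0).rep - KZ.of (KZ.RFun.poly g).rep) -
          (KZ.of (F1.sub F0).rep - (KZ.of F1.rep - KZ.of F0.rep)) := by
      abel
    rw [this]
    exact KZ.relations.sub_mem h' h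
  refine ⟨g, ?_⟩
  have : KZ.of (KZ.RFun.poly p).rep - KZ.of (KZ.RFun.poly g).rep =
      (KZ.of (KZ.RFun.poly p).rep - KZ.of T.dlast.rep) +
        (KZ.of T.dlast.rep - (KZ.of F1.rep - KZ.of F0.rep)) +
        (KZ.of F1.rep - KZ.of F0.rep - KZ.of (KZ.RFun.poly g).rep) := by
    abel
  rw [this]
  exact KZ.relations.add_mem (KZ.relations.add_mem e1 hst) e2

/-- **The tame cube polynomial representation is a rational point**: `[[0,1]^M, p] − [pt, c] ∈
relations` for some `c ∈ ℚ` (descend `M` times with `pbc_descent`; a polynomial in no variables is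
its constant coefficient, and `[0,1]⁰` is the point). [Kontsevich–Zagier 2001, §1.2] [folklore] -/
theorem pbc_cube_toPoint : ∀ (M : ℕ) (p : MvPolynomial (Fin M) ℚ),
    ∃ (c : ℚ) (hc : IsAlgebraic ℚ (c : ℝ)),
      KZ.of (KZ.RFun.poly p).rep - KZ.of (KZ.IntegralRep.unit.constMul (c : ℝ) hc) ∈ KZ.relations
  | 0, p => by
    have hc : IsAlgebraic ℚ ((p.coeff 0 : ℚ) : ℝ) := by
      simpa using isAlgebraic_algebraMap (R := ℚ) (A := ℝ) (p.coeff 0)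
    refine ⟨p.coeff 0, hc, KZ.of_sub_of_mem_relations_of_eqOn ?_ fun x _ => ?_⟩
    · rw [KZ.IntegralRep.domain_constMul, KZ.IntegralRep.unit_domain, KZ.RFun.rep_domain,
        KZ.RFun.cube_zero_eq_univ]
    · show (KZ.RFun.poly p).fn x = ((p.coeff 0 : ℚ) : ℝ) * 1
      rw [KZ.RFun.fn_poly, mul_one]
      conv_lhs => rw [p.eq_C_of_isEmpty]
      rw [MvPolynomial.aeval_C, eq_ratCast]
  | M + 1, p => by
    obtain ⟨g, hg⟩ := pbc_descent M p
    obtain ⟨c, hc, h⟩ := pbc_cube_toPoint M g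
    exact ⟨c, hc, by simpa only [sub_add_sub_cancel] using KZ.relations.add_mem hg h⟩

/-- **STUB `stub_polynomialBoxCell` (v7-6): A RATIONAL POLYNOMIAL OVER A RATIONAL BOX IS A K-CELL.**
A representation on the open rational box `{aᵢ < xᵢ < bᵢ}` (`a < b` in `ℚᵈ`) with integrand a
polynomial `p ∈ ℚ[x]` differs by relations from a point `[pt, v]` with `v` real algebraic: one
affine rule-(2) move `y ↦ diag(b − a) y + a` from the open unit cube carrying the transported
polynomial `q = (∏ (bᵢ − aᵢ))·p(a + (b − a)y)`, the null boundary of the cube (rule (1)), and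
`pbc_cube_toPoint`. [Kontsevich–Zagier 2001, §1.2] [folklore] -/
theorem stub_polynomialBoxCell : ∀ (d : ℕ) (a b : Fin d → ℚ) (p : MvPolynomial (Fin d) ℚ)
    (ρ : KZ.IntegralRep d),
    (∀ i, a i < b i) → ρ.domain = {x : Fin d → ℝ | ∀ i, (a i : ℝ) < x i ∧ x i < (b i : ℝ)} →
    (∀ x ∈ ρ.domain, ρ.integrand x = MvPolynomial.aeval x p) →
    ∃ (v : ℝ) (hv : IsAlgebraic ℚ v),
      KZ.of ρ - KZ.of (KZ.IntegralRep.unit.constMul v hv) ∈ KZ.relations := by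
  intro d a b p ρ hab hdom hint
  -- edge lengths and the transported polynomial on the unit cube
  set w : Fin d → ℚ := fun i => b i - a i with hw
  have hw0 : ∀ i, (0 : ℝ) < w i := fun i => by
    have : (0 : ℚ) < w i := sub_pos.2 (hab i)
    exact_mod_cast this
  set q : MvPolynomial (Fin d) ℚ :=
    C (∏ i, w i) * bind₁ (fun i => C (a i) + C (w i) * X i) p with hq
  have hqfn : ∀ y : Fin d → ℝ, (aeval y q : ℝ) =
      (∏ i, (w i : ℝ)) * aeval (fun i => (a i : ℝ) + (w i : ℝ) * y i) p := fun y => by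
    rw [hq, map_mul, MvPolynomial.aeval_C, aeval_bind₁]
    simp only [map_add, map_mul, MvPolynomial.aeval_C, MvPolynomial.aeval_X, eq_ratCast,
      Rat.cast_prod]
  -- the open unit cube `U` inside the closed cube
  set U : Set (Fin d → ℝ) := {y | ∀ j, y j ∈ Set.Ioo (0:ℝ) 1} with hU
  have hUsub : U ⊆ KZ.cube d := fun y hy => (KZ.mem_cube).2 fun i => ⟨(hy i).1.le, (hy i).2.le⟩
  -- `S = [U, q]`
  let S : KZ.IntegralRep d :=
    { domain := U
      integrand := (KZ.RFun.poly q).fn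
      isSemialgebraic_domain := KZ.isSemialgebraic_box d
      isSemialgebraicFunOn_integrand :=
        (KZ.RFun.poly q).isSemialgebraicFunOn_fn.mono hUsub (KZ.isSemialgebraic_box d)
      integrableOn := (KZ.RFun.poly q).rep.integrableOn.mono_set hUsub }
  -- the affine chart `y ↦ diag(w) y + a`
  set A : Matrix (Fin d) (Fin d) ℝ := Matrix.diagonal fun i => (w i : ℝ) with hAdef
  set sh : Fin d → ℝ := fun i => (a i : ℝ) with hsh
  have hA : ∀ j l, IsAlgebraic ℚ (A j l) := fun j l => by
    rw [hAdef, Matrix.diagonal_apply]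
    split_ifs
    · simpa using isAlgebraic_algebraMap (R := ℚ) (A := ℝ) (w j)
    · exact isAlgebraic_zero
  have hshalg : ∀ j, IsAlgebraic ℚ (sh j) := fun j => by
    simpa [hsh] using isAlgebraic_algebraMap (R := ℚ) (A := ℝ) (a j)
  have hdetA : A.det = ∏ i, (w i : ℝ) := by rw [hAdef, Matrix.det_diagonal]
  have hdet : A.det ≠ 0 := by
    rw [hdetA]
    exact Finset.prod_ne_zero_iff.2 fun i _ => (hw0 i).ne'
  have hchart : ∀ y : Fin d → ℝ, A.mulVec y + sh = fun i => (a i : ℝ) + (w i : ℝ) * y i := fun y => by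
    funext i
    simp only [hAdef, hsh, Pi.add_apply, Matrix.mulVec_diagonal]
    ring
  -- the chart maps `U` onto the box
  have hdom' : ρ.domain = (fun y => A.mulVec y + sh) '' S.domain := by
    rw [hdom]
    ext x
    simp only [mem_setOf_eq, mem_image]
    constructor
    · intro hx
      refine ⟨fun i => (x i - a i) / w i, fun i => ⟨div_pos (sub_pos.2 (hx i).1) (hw0 i), ?_⟩, ?_⟩
      · rw [div_lt_one (hw0 i)]
        have h2 := (hx i).2
        have : (w i : ℝ) = b i - a i := by simp [hw]
        rw [this]
        linarith
      · rw [hchart]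
        funext i
        have hwi : (w i : ℝ) ≠ 0 := (hw0 i).ne'
        field_simp
        ring
    · rintro ⟨y, hy, rfl⟩ i
      have hyi := hy i
      rw [hchart]
      have : (w i : ℝ) = b i - a i := by simp [hw]
      have h2 : (w i : ℝ) * y i < w i := by simpa using mul_lt_mul_of_pos_left hyi.2 (hw0 i)
      have h1 := mul_pos (hw0 i) hyi.1
      constructor
      · show (a i : ℝ) < a i + w i * y i
        linarith
      · show (a i : ℝ) + w i * y i < b i
        linarith
  -- (1) the affine move `[S] − [ρ] ∈ relations`
  have hmove : KZ.of S - KZ.of ρ ∈ KZ.relations := by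
    refine KZ.changeOfVariablesRel_subset_relations
      (Summit.KontsevichZagierPeriods.HyperbolicBloch.OffTetraSectorKernel.aff_orbit_of_sub_of_mem_changeOfVariablesRel
        A sh hA hshalg hdet S ρ hdom' fun y hy => ?_)
    have hy' : A.mulVec y + sh ∈ ρ.domain := by
      rw [hdom']
      exact mem_image_of_mem _ hy
    rw [hint _ hy', hdetA, abs_of_pos (Finset.prod_pos fun i _ => hw0 i), hchart]
    show (KZ.RFun.poly q).fn y = _
    rw [KZ.RFun.fn_poly, hqfn, mul_comm]
  -- (2) the null boundary `[S] − [[0,1]ᵈ, q] ∈ relations`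
  have hnull : KZ.of S - KZ.of (KZ.RFun.poly q).rep ∈ KZ.relations := by
    refine KZ.of_sub_of_mem_relations_of_null S (KZ.RFun.poly q).rep ?_ ?_ fun y _ => rfl
    · show volume (U \ KZ.cube d) = 0
      exact measure_mono_null (fun x hx => (hx.2 (hUsub hx.1)).elim) measure_empty
    · show volume (KZ.cube d \ U) = 0
      refine measure_mono_null (fun x hx => ?_)
        ((measure_iUnion_null_iff (μ := volume)).2 fun i : Fin d =>
          measure_union_null (KZ.BallPeeling.volume_setOf_apply_eq_const d i 0)
            (KZ.BallPeeling.volume_setOf_apply_eq_const d i 1))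
      obtain ⟨hxc, hxU⟩ := hx
      simp only [hU, mem_setOf_eq, not_forall, mem_Ioo, not_and, not_lt] at hxU
      obtain ⟨i, hi⟩ := hxU
      have hci := (KZ.mem_cube.1 hxc) i
      refine mem_iUnion.2 ⟨i, ?_⟩
      rcases hci.1.lt_or_eq with h | h
      · exact Or.inr (le_antisymm hci.2 (hi h))
      · exact Or.inl h.symm
  -- (3) descent to the point
  obtain ⟨c, hc, hpt⟩ := pbc_cube_toPoint d q
  refine ⟨c, hc, ?_⟩
  have : KZ.of ρ - KZ.of (KZ.IntegralRep.unit.constMul (c : ℝ) hc) =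
      (KZ.of S - KZ.of (KZ.RFun.poly q).rep) +
        (KZ.of (KZ.RFun.poly q).rep - KZ.of (KZ.IntegralRep.unit.constMul (c : ℝ) hc)) -
        (KZ.of S - KZ.of ρ) := by
    abel
  rw [this]
  exact KZ.relations.sub_mem (KZ.relations.add_mem hnull hpt) hmove

end Summit.KontsevichZagierPeriods.SymplecticScissors.LogPolytope

end
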